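import Summits.BirchSwinnertonDyer.Rank1Residual.Additive.RamifiedSevenGenusKatoExpUnitLawsPositionOfFP1ExactFrame
import HarnessLib

set_option autoImplicit false

/-!
# `𝒞₇` genus road (crux `EllipticUnitValueSevenOfGZK` = stmt-BirchSwinnertonDyer-19945, K7r), (K-2★) part 3/3 — THE LETTER:
# `GenusSeven.katoExpUnitLawsWithPositionSeven_of_FP1exact'` (pen D1172 (2) / D1173, letter (R-a))

Cell bsd-cm, seat bsd-cm-k-ty1 g36; pen bsd-cm-plan g39 D1166/D1172/D1173, g40 D1175; critic idea-crit-15 g19.  PURE KERNEL: one theorem —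
part 2's `PinnedKatoGenusFrame.unitLawsWithPosition_of_FP1exact` at the frame of record `Φ := katoGenusFrameOfRecord … D₃.toKummerColumnData d`
(`subst`; the junctions `Φ.sqrtNegSeven = s`, `Φ.𝔣 = (s)(|D|)`, `Φ.ψ = D₃.ψ`, `Φ.euK = D₃.euK`, `Φ.𝔏 = D₃.𝔏` are `rfl`; the frame term is passed
explicitly to the §2 theorem — with `_` the unifier times out on the `Kcm`/`Φ.Kcm` instances of the Betti binders).

THE LETTER: the frame binders of the zp v22 stubs `stub_katoExpUnitLawsSeven` / `stub_periodPositionLawSeven`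
(`Cruxes/EllipticUnitValueSevenOfGZK/Lines/kato_perrin_riou_zp.lean` 21191cec33e1747a, l.986–1013) VERBATIM through
`Φ = katoGenusFrameOfRecord … →`; then the Betti ∀-antecedents of F-P1-EXACT′ read AT THE PARTNER `D₃.W₂` through the frame's `Kcm, ι₀, s`
(`∀ (L : PeriodPair), IsNeronLatticeOf (D₃.W₂.baseChange ℂ) L → ∀ (lam0 : ℂ), (∀ z : ℂ, z ∈ L.lattice ↔ ∃ a : 𝓞 Kcm, z = lam0 * ι₀ (a : Kcm)) →
∀ (κ' : Kcm), ι₀ κ' * ((D₃.W₂.realPeriodRat : ℝ) : ℂ) = ι₀ (s : Kcm) * lam0 →`) and the real-period ratio (`∀ (r : ℚ), (r : ℝ) * W.realPeriodRat =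
D₃.W₂.realPeriodRat →`; no `r ≠ 0` binder — it follows from `Ω_{W₂} > 0`); CONCLUSION `∃ uStar e′ α₀ α₁ (hα) n₀, <hZ law VERBATIM (v22 l.1014–1022)> ∧
((α₀ ^ 2 + 7 * α₁ ^ 2).valuation : ℤ) − 2 * (e′ : ℤ) = 2 * (Φ.k : ℤ) + 2 * padicValRat 7 r + padicValRat 7 (Algebra.norm ℚ κ')` (the `R` of part 2's
docstring table).  CONSUMES (for the pen's touch (12)): `hFP1x : CM.kato15161_ellipticUnitClass_res_zetaFamily_exact'` (p828201), `hTA2 :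
DokchitserDokchitser2015.padicLogLocal_dual_eq_of_isogenyPair_coprime` (p827831), `hCMT : CM.artin_natCast_smul_torsion`, `hMP :
nonempty_modularParametrizationData`, `hLev : ∀ {N} [NeZero N], IsNewformOf.level_eq_conductorNorm`; of the stub's own binders only `hγ, hR, hι₀, s,
D₃, ι₇` (and the frame) are used.  This theorem closes NO stub by itself: (S-★′) `stub_periodPositionLawSeven` follows from it + (S-P) (Betti
existence and `2·v₇(r) + v₇(Nm κ′) ≤ Φ.a`, LEMMA P) + (T-R) (rigidity of solutions), in the pen's zp v23.

HONEST LABEL: kernel theorems CONDITIONAL on the displayed named facts (`hFP1x` F-P1-EXACT′, `hTA2` (T-A2)′, `hCMT`, `hMP`, `hLev`) and on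
the stub's `hR`; the Betti data and `r` are ∀-antecedents, NOT shown to exist here (their existence and the bound `R ≤ 2Φ.k + Φ.a` are the
pen's research stub (S-P) = LEMMA P); (S-★′) needs in addition the rigidity (T-R); these files close NO stub by themselves;
stmt-BirchSwinnertonDyer-19945 stays OPEN (zp v22 21191cec33e1747a, 4 sorries); `X12.CMRamifiedSeven` is NOT proved; no summit statement is
proved by this seat; BSD is claimed for no curve.

## References
* K. Kato, Astérisque 295 (2004): Thm. 12.5 (1) (p. 221), §13.9 and Lemma 13.10 (1) (p. 230), Prop. 15.9 (15.9.1) (pp. 258–259), Lemma 15.11 (2)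
  (pp. 261–262), (15.12.1) (p. 263), 15.14 (p. 264), (15.16.1) (p. 265). [Kato2004Asterisque]
* T. Dokchitser, V. Dokchitser, Trans. AMS 367 (2015), §4 Lemma 10–11. [DokchitserDokchitser2015LocalInvariants]
* J. H. Silverman, *AEC* (2009), Thm. VI.5.1, Prop. VI.3.6 (b), C.16. [SilvermanAEC2009]   L. Washington (1997), Thm. 7.3, §13.2. [Washington1997]
* Tree: g35 `Additive/RamifiedSevenGenusPartnerFP1.lean` (p826701), `Additive/RamifiedSevenGenusKatoExpUnitLawsOfFP1.lean` (p826824);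
  `Kato2004/EllipticUnitZetaClassComparisonExactScaled.lean` (p828201), `Kato2004/DefinedExpStarBodyIsogenyTransportNeron.lean` (p828320),
  `DokchitserDokchitser2015/PadicLogIsogenyInvariance.lean` (p827831); zp v22 `Cruxes/EllipticUnitValueSevenOfGZK/Lines/kato_perrin_riou_zp.lean` l.985–1025.
-/

noncomputable section

open scoped NumberField TensorProduct
open WeierstrassCurve Field NumberField IsDedekindDomain
open Literature.NumberTheory.IwasawaTheory
open Literature.NumberTheory.GaloisRepresentations Literature.NumberTheory.GaloisRepresentations.LocalWeilDatum
open Literature.NumberTheory.EllipticCurves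
open Literature.NumberTheory.EllipticCurves.Rank1Residual
open Literature.NumberTheory.EllipticCurves.IwasawaAlgebra
open Literature.NumberTheory.EllipticCurves.Kato2004
open Literature.NumberTheory.EllipticCurves.ModularForms
open Literature.NumberTheory.ComplexMultiplication.EllipticUnits
open Summit.BirchSwinnertonDyer.Rank1Residual

namespace Summit.BirchSwinnertonDyer.Rank1Residual.Additive.GenusSeven

/-! ## §3 ★★★ (K-2★): the law of (S-D-★′) with the closed position equation, at the frame of record -/

set_option maxHeartbeats 4000000 in
open GenusSeven.ArithmeticInputs in
/-- ★★★ **(K-2★) — KATO'S 7-ADIC ★-VALUE LAW WITH ITS PERIOD POSITION ON THE RECORD-FED FRAME** (module docstring «THE LETTER»): the zp v22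
frame binders VERBATIM, the Betti / period-ratio ∀-antecedents at the partner, then `∃ uStar e′ α₀ α₁ (hα) n₀, <hZ law VERBATIM> ∧
((α₀ ^ 2 + 7 * α₁ ^ 2).valuation : ℤ) − 2 * e′ = 2 * Φ.k + 2 * padicValRat 7 r + padicValRat 7 (Algebra.norm ℚ κ')` — part 2 at
`Φ := katoGenusFrameOfRecord … D₃.toKummerColumnData d` (`subst`; five `rfl` junctions, as g35's (K-2)).  CONSUMES the five displayed named
facts; closes NO stub by itself ((S-★′) needs (S-P) = LEMMA P and (T-R)).
[cite: Kato2004Asterisque, Thm. 12.5 (1) (p. 221), §13.9 (p. 230), Lemma 13.10 (1) (p. 230), Prop. 15.9 (15.9.1) (pp. 258–259), Lemma 15.11 (2) (pp. 261–262), (15.12.1)–(15.12.2) (pp. 262–263), 15.14 (p. 264), (15.16.1) (p. 265)]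
[cite: DokchitserDokchitser2015LocalInvariants, §4 Lemma 10–11] [cite: BlochKato1990, Def. 3.10 and Ex. 3.11 (pp. 359–361)] [cite: Washington1997, §13.1 and Prop. 13.2] -/
theorem katoExpUnitLawsWithPositionSeven_of_FP1exact'
    (hFP1x : CM.kato15161_ellipticUnitClass_res_zetaFamily_exact')
    (hTA2 : DokchitserDokchitser2015.padicLogLocal_dual_eq_of_isogenyPair_coprime) (hCMT : CM.artin_natCast_smul_torsion)
    (hMP : nonempty_modularParametrizationData)
    (hLev : ∀ {N : ℕ} [NeZero N], IsNewformOf.level_eq_conductorNorm (N := N)) :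
    ∀ (hstar : Kato2004.exists_zetaClassPosition_of_rank_le_one) (hGZK : rank_eq_analyticRank_of_analyticRank_le_one)
      (h25 : DeShalit1987.prop25_i_normRelation)
      (hM1 : CM.rayClassField_le_torsionField) (hM1' : CM.torsionField_le_rayClassField_of_conductor)
      (h155u : Kato2004.kato155_isUnit_of_two_le_primeDivisors)
      {W : WeierstrassCurve ℚ} [W.IsElliptic] [W.IsGloballyMinimal] [Fact (Nat.Prime 7)] (hC : X12.ClassCSeven W)
      [ContinuousSMul ℤ_[7] (W.tateModule 7)] (K : ZpExtension ℚ 7) (hK : K.IsCyclotomic)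
      {γ : Field.absoluteGaloisGroup ℚ} (hγ : K.IsTopGenerator γ) (I : IwasawaH1Data W 7 K γ)
      (hR : ∃ z₀ : I.H, Kato2004.IsAdmissibleZetaClass W 7 K hK I z₀)
      (F : GenusFrame) (hbad : ∀ (q : ℕ) [Fact q.Prime], q ≠ 7 → (¬ Good W q ↔ q ∣ F.d))
      (Kcm : Type) [Field Kcm] [NumberField Kcm] (h2 : Module.finrank ℚ Kcm = 2) (s : 𝓞 Kcm) (hs : (s : Kcm) ^ 2 = -7)
      (ι₀ : Kcm →+* ℂ) (hι₀ : ∀ (w : InfinitePlace Kcm) (x : Kcm), ι₀ x = w.embedding x)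
      (e : AlgebraicClosure Kcm →+* AlgebraicClosure ℚ)
      [ContinuousSMul ℤ_[7] ((W.baseChange Kcm).tateModule 7)]
      (γK : Field.absoluteGaloisGroup Kcm) (hγK : (K.restrictOfFinrankEqTwo (by decide) Kcm h2).IsTopGenerator γK)
      (IK : IwasawaH1DataOver (W.baseChange Kcm) 7 (K.restrictOfFinrankEqTwo (by decide) Kcm h2) γK)
      (φ : Isogeny (W.baseChange Kcm) (W.baseChange Kcm)) (hφ : ∀ P, φ (φ P) = (-7 : ℤ) • P)
      (𝔞 : Ideal (𝓞 Kcm)) (h𝔞 : IsTwist 7 (Ideal.span {s} * Ideal.span {((F.d : ℕ) : 𝓞 Kcm)}) 𝔞)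
      (hN𝔞 : Ideal.absNorm 𝔞 = F.normA) (z : ℕ → (AlgebraicClosure Kcm)ˣ)
      (hz : ∀ n : ℕ, IsKatoUnitRep 7 ι₀ (Ideal.span {s} * Ideal.span {((F.d : ℕ) : 𝓞 Kcm)}) (n + 1) 𝔞 (z n))
      (hη : ∀ (g₁ : geomTorsion (W.baseChange Kcm) ((7 : ℤ) ^ 1) →+ geomTorsion (W.baseChange Kcm) ((7 : ℤ) ^ 1)),
        (∀ P, ((g₁ P : geomTorsion (W.baseChange Kcm) ((7 : ℤ) ^ 1)) : geomPoints (W.baseChange Kcm)) =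
          φ (P : geomPoints (W.baseChange Kcm))) →
        ∀ (σ : Field.absoluteGaloisGroup Kcm) (a : ℕ) (ζ' : AlgebraicClosure Kcm), e ζ' = F.ζsys 0 → σ • ζ' = ζ' ^ a →
          ∀ P : geomTorsion (W.baseChange Kcm) ((7 : ℤ) ^ 1), g₁ P = 0 →
            σ • (P : geomPoints (W.baseChange Kcm)) =
              ((PadicInt.toZMod ((F.χD (a : ZMod F.d)) * (F.ω (a : ZMod 7)) ^ 5)).val : ℤ) • (P : geomPoints (W.baseChange Kcm)))
      (D₃ : KummerColumnDataRat W Kcm h2 K IK ι₀ (Ideal.span {s} * Ideal.span {((F.d : ℕ) : 𝓞 Kcm)}) F.d φ)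
      (d : GenusDatum F (normedFamilyOf F Kcm h2 s hs ι₀ e 𝔞 h𝔞 hN𝔞 z hz h155u))
      (ι₇ : ℚ_[7] →+* ℂ)
      (Φ : PinnedKatoGenusFrame W K hK I d),
      Φ = katoGenusFrameOfRecord hstar hGZK h25 hM1 hM1' h155u hC K hK hγ I F hbad Kcm h2 s hs ι₀ hι₀ e γK hγK IK φ hφ 𝔞 h𝔞 hN𝔞 z hz hη
            D₃.toKummerColumnData d →
      -- the Betti antecedents AT THE PARTNER (EXACT′'s shape read at `D₃.W₂`, through the frame's `Kcm, ι₀, s`) and the real-period ratio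
      ∀ (L : PeriodPair), IsNeronLatticeOf (D₃.W₂.baseChange ℂ) L → ∀ (lam0 : ℂ),
        (∀ z : ℂ, z ∈ L.lattice ↔ ∃ a : 𝓞 Kcm, z = lam0 * ι₀ (a : Kcm)) →
      ∀ (κ' : Kcm), ι₀ κ' * ((D₃.W₂.realPeriodRat : ℝ) : ℂ) = ι₀ (s : Kcm) * lam0 →
      ∀ (r : ℚ), (r : ℝ) * W.realPeriodRat = D₃.W₂.realPeriodRat →
      ∃ (uStar : (IwasawaAlgebra 7)ˣ) (e' : ℕ) (α₀ α₁ : ℤ_[7]) (_ : α₀ ≠ 0 ∨ α₁ ≠ 0) (n₀ : ℕ),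
        (∀ (n : ℕ), n₀ ≤ n → ∀ (χ : absoluteGaloisGroup Φ.Kcm →ₜ* ℂˣ),
          (∀ σ ∈ Φ.towerK.layerSubgroup (n + 1), χ σ = 1) →
          IsPrimitiveRoot (((χ Φ.γK : ℂˣ)) : ℂ) (7 ^ (n + 1)) →
          ∀ Lf : ℂ → ℂ, CM.IsDepletedHeckeL Φ.ψ χ (7 * (7 * F.d)) Lf →
            (7 : ℂ) ^ e' * Φ.valOf ι₇ χ (uStar⁻¹ • I.resOver Φ.IK hγ Φ.isTopGenerator_γK Φ.zOne) =
              (ι₇ (α₀ : ℚ_[7]) + ι₇ (α₁ : ℚ_[7]) * Φ.ιC (algebraMap Φ.Kcm (AlgebraicClosure Φ.Kcm) Φ.sqrtNegSeven)) * Φ.Ω⁻¹ * Lf 1) ∧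
        (((α₀ ^ 2 + 7 * α₁ ^ 2).valuation : ℕ) : ℤ) - 2 * (e' : ℤ) =
          2 * (Φ.k : ℤ) + 2 * padicValRat 7 r + padicValRat 7 (Algebra.norm ℚ κ') := by
  intro hstar hGZK h25 hM1 hM1' h155u W _ _ _ hC _ K hK γ hγ I hR F hbad Kcm _ _ h2 s hs ι₀ hι₀ e _ γK hγK IK φ hφ 𝔞 h𝔞 hN𝔞 z
    hz hη D₃ d ι₇ Φ hΦ
  subst hΦ
  intro L hNL lam0 hlam0 κ' hκ' r hr
  -- (the frame is passed explicitly: with `_` the unifier times out on the Betti binders' `Kcm`/`Φ.Kcm` instances)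
  exact PinnedKatoGenusFrame.unitLawsWithPosition_of_FP1exact hFP1x hTA2 hCMT hMP hLev hγ hR
    (katoGenusFrameOfRecord hstar hGZK h25 hM1 hM1' h155u hC K hK hγ I F hbad Kcm h2 s hs ι₀ hι₀ e γK hγK IK φ hφ 𝔞 h𝔞 hN𝔞 z
      hz hη D₃.toKummerColumnData d) s rfl rfl ι₀ hι₀ D₃ rfl rfl rfl ι₇
    L hNL lam0 hlam0 κ' hκ' r hr

end Summit.BirchSwinnertonDyer.Rank1Residual.Additive.GenusSeven

end
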